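import Summits.AtomisticToContinuum.HydrodynamicLimit.Theorems.EnskogAdjointDualityAdjointEnskogTestFamilyRMaxwellianParam
import Summits.AtomisticToContinuum.HydrodynamicLimit.Theorems.EnskogAdjointDualityDualityReductionProfiles
import Literature.Analysis.FunctionSpaces.TorusSpaceTime
import HarnessLib

/-!
# EnskogAdjointDuality / AdjointEnskogTestFamilyR — Maxwellian characteristic derivative,
# part 2: the local Maxwellian along free-flight characteristics — regularity and decay

Support lemmas for the stub `stub_maxwellianCharDeriv` (B2) of the line `birth` of the crux
`Summit.AtomisticToContinuum.HydrodynamicLimit.Theses.EnskogAdjointDuality.AdjointEnskogTestFamilyR`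
(stmt-AtomisticToContinuum-11592). For fields `ρ, θ, u` jointly smooth on `S × 𝕋³`
(`Torus.IsSmoothSpaceTimeOn S`) and the free-flight characteristic `r ↦ (r, x + (r − s)v)`
through `(s, x)`:

* `k2r_contDiffOn_field_char`, `k2r_hasDerivWithinAt_field_char` — a field along a
  characteristic is smooth in `r ∈ S`, with derivative the convective derivative
  `∂ₜg + Dg[v]` (`Torus.timeDerivWithin S g s x + Torus.fderiv (g s) x v`);
* `k2r_contDiffOn_maxwellian_char`, `k2r_hasDerivWithinAt_maxwellian_char`,
  `k2r_derivWithin_maxwellian_char` — the same for `f = ρ M_{1,θ,u}`, with the explicit kernel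
  `M [Dρ + ρ (Dθ (|v−u|²/(2θ²) − 3/(2θ)) + ⟪Du, v−u⟫/θ)]`, and the resulting formula for the
  crux's `derivWithin (…) (Icc 0 t) s`;
* `k2r_continuous_frozen_maxwellian` — joint continuity of the time-frozen `f` (clause (R1));
* `k2r_exists_pos_le_window`, `k2r_exists_convective_bound`, `k2r_eulerWindow` — window constants
  of a classical Euler solution on `[0, t]`, `t < T` (bounds of the fields, a positive lower bound
  of `θ`, bounds of the first derivatives, linear growth of the convective derivatives);
* `k2r_maxwellian_decay` — clause (R3): `|f| (1+|v|)⁸ ≤ C_F` and `|Df| (1+|v|)⁸ ≤ C_F` on `[0, t]`.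

References: C. Cercignani, R. Illner, M. Pulvirenti, *The Mathematical Theory of Dilute Gases*
(1994), §3.3 [CIP1994].
-/

noncomputable section

open MeasureTheory Set Filter Topology Function
open scoped InnerProductSpace ContDiff BigOperators

namespace Summit.AtomisticToContinuum.HydrodynamicLimit.Theorems.EnskogAdjointDuality

open Literature.Analysis.FluidPDE Literature.MathematicalPhysics.KineticTheory
  Literature.Analysis.FunctionSpaces

section Fields

variable {F : Type*} [NormedAddCommGroup F] [NormedSpace ℝ F] {S : Set ℝ} {g : ℝ → T3 → F}

/-- A jointly smooth field evaluated along the free-flight characteristic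
`r ↦ (r, x + (r − s)v)` is smooth in `r ∈ S` (the characteristic lifts to an affine line in
`ℝ × ℝ³`). [folklore] -/
theorem k2r_contDiffOn_field_char (hg : Torus.IsSmoothSpaceTimeOn S g) (x : T3) (v : V3) (s : ℝ) :
    ContDiffOn ℝ ∞ (fun r => g r (x + Torus.proj ((r - s) • v))) S := by
  have h : (fun r => g r (x + Torus.proj ((r - s) • v))) =
      Torus.stLift g ∘ fun r => (r, Torus.repr x + (r - s) • v) := by
    funext r
    simp only [comp_apply, Torus.stLift_apply, Torus.proj_add, Torus.proj_repr]
  rw [h]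
  exact hg.comp (by fun_prop) fun r hr => ⟨hr, mem_univ _⟩

/-- **Convective derivative along a characteristic.** For `s ∈ S` (a time set of unique
differentiability), `r ↦ g r (x + (r − s)v)` has derivative `∂ₜg(s,x) + Dg(s,·)(x)[v]` at `s`
within `S`. [folklore] -/
theorem k2r_hasDerivWithinAt_field_char (hg : Torus.IsSmoothSpaceTimeOn S g) (hS : UniqueDiffOn ℝ S)
    {s : ℝ} (hs : s ∈ S) (x : T3) (v : V3) :
    HasDerivWithinAt (fun r => g r (x + Torus.proj ((r - s) • v)))
      (Torus.timeDerivWithin S g s x + Torus.fderiv (g s) x v) S s := by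
  obtain ⟨y, rfl⟩ := Torus.proj_surjective x
  set A : ℝ → ℝ × V3 := fun r => (r, y + (r - s) • v) with hA
  have hAs : A s = (s, y) := by simp [hA]
  have h1 : HasFDerivWithinAt (Torus.stLift g) (fderivWithin ℝ (Torus.stLift g) (S ×ˢ univ) (s, y))
      (S ×ˢ univ) (A s) := by
    rw [hAs]
    exact (hg.differentiableOn (by simp) (s, y) ⟨hs, mem_univ _⟩).hasFDerivWithinAt
  have h2 : HasDerivWithinAt A ((1 : ℝ), v) S s := by
    refine (hasDerivWithinAt_id s S).prodMk ?_
    have h : HasDerivWithinAt (fun r : ℝ => y + (r - s) • v) ((1 : ℝ) • v) S s :=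
      (((hasDerivWithinAt_id s S).sub_const s).smul_const v).const_add y
    rwa [one_smul] at h
  have h3 := h1.comp_hasDerivWithinAt s h2 fun r hr => ⟨hr, mem_univ _⟩
  have hfun : Torus.stLift g ∘ A = fun r => g r (Torus.proj y + Torus.proj ((r - s) • v)) := by
    funext r
    simp only [comp_apply, hA, Torus.stLift_apply, Torus.proj_add]
  rw [hfun] at h3
  refine h3.congr_deriv ?_
  have hsplit : ((1 : ℝ), v) = ((1 : ℝ), (0 : V3)) + ((0 : ℝ), v) := by simp
  rw [hsplit, ContinuousLinearMap.map_add, ← hg.timeDerivWithin_apply_proj hS hs y,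
    ← hg.fderiv_slice_apply hs y v]

end Fields

section Maxwellian

variable {S : Set ℝ} {ρ θ : ℝ → T3 → ℝ} {u : ℝ → T3 → V3}

/-- The Euler local Maxwellian `f = ρ M_{1,θ,u}` along a free-flight characteristic is smooth
in `r ∈ S` (for jointly smooth fields with `θ > 0` on `S`). [cite: CIP1994, §3.3] -/
theorem k2r_contDiffOn_maxwellian_char (hρ : Torus.IsSmoothSpaceTimeOn S ρ)
    (hθ : Torus.IsSmoothSpaceTimeOn S θ) (hu : Torus.IsSmoothSpaceTimeOn S u)
    (hpos : ∀ r ∈ S, ∀ x, 0 < θ r x) (x : T3) (v : V3) (s : ℝ) :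
    ContDiffOn ℝ ∞ (fun r => ρ r (x + Torus.proj ((r - s) • v)) *
      localMaxwellian 1 (θ r (x + Torus.proj ((r - s) • v)))
        (u r (x + Torus.proj ((r - s) • v))) v) S := by
  have hmap : ContDiffOn ℝ ∞ (fun r => ((ρ r (x + Torus.proj ((r - s) • v)),
      θ r (x + Torus.proj ((r - s) • v)), u r (x + Torus.proj ((r - s) • v)), v) :
        ℝ × ℝ × V3 × V3)) S :=
    (k2r_contDiffOn_field_char hρ x v s).prodMk ((k2r_contDiffOn_field_char hθ x v s).prodMk
      ((k2r_contDiffOn_field_char hu x v s).prodMk contDiffOn_const))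
  exact k2r_contDiffOn_localMaxwellian_param.comp hmap fun r hr => hpos r hr _

/-- **The characteristic derivative of the local Maxwellian.** For `s ∈ S` (unique
differentiability) and `θ(s,x) > 0`, `r ↦ f(r, x + (r−s)v, v)` has derivative
`M_{1,θ,u}(v) [Dρ + ρ (Dθ (|v−u|²/(2θ²) − 3/(2θ)) + ⟪Du, v−u⟫/θ)]` at `s` within `S`, where
`Dg = ∂ₜg(s,x) + Dg(s,·)(x)[v]` is the convective derivative and the fields are taken at
`(s, x)`. [cite: CIP1994, §3.3] -/
theorem k2r_hasDerivWithinAt_maxwellian_char (hρ : Torus.IsSmoothSpaceTimeOn S ρ)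
    (hθ : Torus.IsSmoothSpaceTimeOn S θ) (hu : Torus.IsSmoothSpaceTimeOn S u)
    (hS : UniqueDiffOn ℝ S) {s : ℝ} (hs : s ∈ S) (x : T3) (hpos : 0 < θ s x) (v : V3) :
    HasDerivWithinAt (fun r => ρ r (x + Torus.proj ((r - s) • v)) *
      localMaxwellian 1 (θ r (x + Torus.proj ((r - s) • v)))
        (u r (x + Torus.proj ((r - s) • v))) v)
      (localMaxwellian 1 (θ s x) (u s x) v *
        ((Torus.timeDerivWithin S ρ s x + Torus.fderiv (ρ s) x v) +
          ρ s x * ((Torus.timeDerivWithin S θ s x + Torus.fderiv (θ s) x v) *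
            (‖v - u s x‖ ^ 2 / (2 * θ s x ^ 2) - 3 / (2 * θ s x)) +
            ⟪Torus.timeDerivWithin S u s x + Torus.fderiv (u s) x v, v - u s x⟫_ℝ / θ s x)))
      S s := by
  have hpos' : 0 < θ s (x + Torus.proj ((s - s) • v)) := by simpa using hpos
  have h := k2r_hasDerivWithinAt_localMaxwellian_param (k2r_hasDerivWithinAt_field_char hρ hS hs x v)
    (k2r_hasDerivWithinAt_field_char hθ hS hs x v) (k2r_hasDerivWithinAt_field_char hu hS hs x v)
    hpos' v
  simp only [sub_self, zero_smul, Torus.proj_zero, add_zero] at h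
  exact h

/-- The crux's characteristic derivative `Df(s,x,v) = derivWithin (r ↦ f(r, x+(r−s)v, v)) [0,t] s`
of the local Maxwellian of fields jointly smooth on `[0,T)`, for `s ∈ [0,t]`, `0 < t < T`: the
explicit kernel with the convective derivatives taken within `[0,T)`. [cite: CIP1994, §3.3] -/
theorem k2r_derivWithin_maxwellian_char {T t : ℝ} (hρ : Torus.IsSmoothSpaceTimeOn (Ico 0 T) ρ)
    (hθ : Torus.IsSmoothSpaceTimeOn (Ico 0 T) θ) (hu : Torus.IsSmoothSpaceTimeOn (Ico 0 T) u)
    (hpos : ∀ r ∈ Ico 0 T, ∀ x, 0 < θ r x) (ht : 0 < t) (htT : t < T) {s : ℝ} (hs : s ∈ Icc 0 t)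
    (x : T3) (v : V3) :
    derivWithin (fun r => ρ r (x + Torus.proj ((r - s) • v)) *
      localMaxwellian 1 (θ r (x + Torus.proj ((r - s) • v)))
        (u r (x + Torus.proj ((r - s) • v))) v) (Icc 0 t) s =
      localMaxwellian 1 (θ s x) (u s x) v *
        ((Torus.timeDerivWithin (Ico 0 T) ρ s x + Torus.fderiv (ρ s) x v) +
          ρ s x * ((Torus.timeDerivWithin (Ico 0 T) θ s x + Torus.fderiv (θ s) x v) *
            (‖v - u s x‖ ^ 2 / (2 * θ s x ^ 2) - 3 / (2 * θ s x)) +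
            ⟪Torus.timeDerivWithin (Ico 0 T) u s x + Torus.fderiv (u s) x v, v - u s x⟫_ℝ /
              θ s x)) := by
  have hsub : Icc 0 t ⊆ Ico 0 T := fun r hr => ⟨hr.1, hr.2.trans_lt htT⟩
  have hs' : s ∈ Ico 0 T := hsub hs
  exact ((k2r_hasDerivWithinAt_maxwellian_char hρ hθ hu (uniqueDiffOn_Ico 0 T) hs' x
    (hpos s hs' x) v).mono hsub).derivWithin (uniqueDiffOn_Icc ht s hs)

/-- `C¹` regularity of the local Maxwellian along every characteristic `r ↦ (r, x + r v)` on
`[0, t]`, `t < T` (clause (R2) of the stub). [cite: CIP1994, §3.3] -/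
theorem k2r_contDiffOn_one_maxwellian_char {T t : ℝ} (hρ : Torus.IsSmoothSpaceTimeOn (Ico 0 T) ρ)
    (hθ : Torus.IsSmoothSpaceTimeOn (Ico 0 T) θ) (hu : Torus.IsSmoothSpaceTimeOn (Ico 0 T) u)
    (hpos : ∀ r ∈ Ico 0 T, ∀ x, 0 < θ r x) (htT : t < T) (x : T3) (v : V3) :
    ContDiffOn ℝ 1 (fun r => ρ r (x + Torus.proj (r • v)) *
      localMaxwellian 1 (θ r (x + Torus.proj (r • v))) (u r (x + Torus.proj (r • v))) v)
      (Icc 0 t) := by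
  have hsub : Icc 0 t ⊆ Ico 0 T := fun r hr => ⟨hr.1, hr.2.trans_lt htT⟩
  have h := (k2r_contDiffOn_maxwellian_char hρ hθ hu hpos x v 0).of_le (by simp : (1 : WithTop ℕ∞) ≤ ∞)
  simp only [sub_zero] at h
  exact h.mono hsub

end Maxwellian

section Frozen

variable {ρ θ : ℝ → T3 → ℝ} {u : ℝ → T3 → V3} {t : ℝ}

/-- **Joint continuity of the time-frozen local Maxwellian** (clause (R1) of the stub): if
`ρ, θ, u` are jointly continuous on `[0, t] × 𝕋³` with `θ > 0` there, then
`(s, x, v) ↦ f(π s, x, v)` is continuous, `π` the projection onto `[0, t]`. [folklore] -/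
theorem k2r_continuous_frozen_maxwellian (ht : 0 ≤ t)
    (hρc : ContinuousOn (uncurry ρ) (Icc 0 t ×ˢ univ))
    (hθc : ContinuousOn (uncurry θ) (Icc 0 t ×ˢ univ))
    (huc : ContinuousOn (uncurry u) (Icc 0 t ×ˢ univ))
    (hpos : ∀ s ∈ Icc 0 t, ∀ x, 0 < θ s x) :
    Continuous fun p : ℝ × T3 × V3 =>
      ρ (max 0 (min t p.1)) p.2.1 *
        localMaxwellian 1 (θ (max 0 (min t p.1)) p.2.1) (u (max 0 (min t p.1)) p.2.1) p.2.2 := by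
  have hπ : ∀ s : ℝ, max 0 (min t s) ∈ Icc 0 t := fun s =>
    ⟨le_max_left _ _, max_le ht (min_le_left _ _)⟩
  have hq : Continuous fun p : ℝ × T3 × V3 => ((p.1, p.2.1) : ℝ × T3) := by fun_prop
  have hρ' : Continuous fun p : ℝ × T3 × V3 => ρ (max 0 (min t p.1)) p.2.1 :=
    (continuous_frozen ht hρc).comp hq
  have hθ' : Continuous fun p : ℝ × T3 × V3 => θ (max 0 (min t p.1)) p.2.1 :=
    (continuous_frozen ht hθc).comp hq
  have hu' : Continuous fun p : ℝ × T3 × V3 => u (max 0 (min t p.1)) p.2.1 :=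
    (continuous_frozen ht huc).comp hq
  have hmap : Continuous fun p : ℝ × T3 × V3 => ((ρ (max 0 (min t p.1)) p.2.1,
      θ (max 0 (min t p.1)) p.2.1, u (max 0 (min t p.1)) p.2.1, p.2.2) : ℝ × ℝ × V3 × V3) :=
    hρ'.prodMk (hθ'.prodMk (hu'.prodMk continuous_snd.snd))
  exact k2r_contDiffOn_localMaxwellian_param.continuousOn.comp_continuous hmap
    fun p => hpos _ (hπ p.1) _

end Frozen

/-! ## Uniform decay on a compact time window -/

/-- A positive field, jointly continuous on the compact window `[0, t] × 𝕋³`, is bounded below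
there by a positive constant. [folklore] -/
theorem k2r_exists_pos_le_window {g : ℝ → T3 → ℝ} {t : ℝ} (ht : 0 ≤ t)
    (hg : ContinuousOn (uncurry g) (Icc 0 t ×ˢ univ)) (hpos : ∀ s ∈ Icc 0 t, ∀ x, 0 < g s x) :
    ∃ m : ℝ, 0 < m ∧ ∀ s ∈ Icc 0 t, ∀ x, m ≤ g s x := by
  have hK : IsCompact (Icc 0 t ×ˢ (univ : Set T3)) := isCompact_Icc.prod isCompact_univ
  have hne : (Icc 0 t ×ˢ (univ : Set T3)).Nonempty :=
    ⟨(0, 0), ⟨left_mem_Icc.2 ht, mem_univ _⟩⟩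
  obtain ⟨p, hp, hmin⟩ := hK.exists_isMinOn hne hg
  refine ⟨g p.1 p.2, hpos p.1 hp.1 p.2, fun s hs x => ?_⟩
  exact hmin (show (s, x) ∈ Icc 0 t ×ˢ univ from ⟨hs, mem_univ _⟩)

/-- **Bounds on the first derivatives of a jointly smooth field on a compact window.** For a
field jointly smooth on `[0, T)` and `t < T` there is `B` bounding, for all `s ∈ [0, t]`,
`x ∈ 𝕋³`: the time derivative `‖∂ₜg(s,x)‖ ≤ B`, the partial derivatives `‖∂ᵢg(s,·)(x)‖ ≤ B`, and
the convective derivatives `‖∂ₜg(s,x) + Dg(s,·)(x)[v]‖ ≤ B (1 + |v|)` for all `v ∈ ℝ³` (the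
derivative fields are again jointly smooth, hence bounded on the compact window). [folklore] -/
theorem k2r_exists_convective_bound {F : Type*} [NormedAddCommGroup F] [NormedSpace ℝ F]
    {T t : ℝ} {g : ℝ → T3 → F} (hg : Torus.IsSmoothSpaceTimeOn (Ico 0 T) g) (htT : t < T) :
    ∃ B : ℝ, 0 ≤ B ∧ ∀ s ∈ Icc 0 t, ∀ (x : T3),
      ‖Torus.timeDerivWithin (Ico 0 T) g s x‖ ≤ B ∧
      (∀ i : Fin 3, ‖Torus.partialDeriv i (g s) x‖ ≤ B) ∧
      ∀ v : V3, ‖Torus.timeDerivWithin (Ico 0 T) g s x + Torus.fderiv (g s) x v‖ ≤ B * (1 + ‖v‖) := by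
  have hsub : Icc 0 t ⊆ Ico 0 T := fun r hr => ⟨hr.1, hr.2.trans_lt htT⟩
  have hU := uniqueDiffOn_Ico 0 T
  obtain ⟨B₀, hB₀⟩ := (hg.timeDerivWithin hU).exists_norm_le_of_isCompact isCompact_Icc hsub
  have hB : ∀ i : Fin 3, ∃ Bi : ℝ, ∀ s ∈ Icc 0 t, ∀ x, ‖Torus.partialDeriv i (g s) x‖ ≤ Bi :=
    fun i => (hg.partialDeriv hU i).exists_norm_le_of_isCompact isCompact_Icc hsub
  choose Bp hBp using hB
  have h1 : 0 ≤ |B₀| := abs_nonneg _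
  have h2 : 0 ≤ ∑ i, |Bp i| := Finset.sum_nonneg fun i _ => abs_nonneg _
  refine ⟨|B₀| + ∑ i, |Bp i|, by positivity, fun s hs x => ⟨?_, fun i => ?_, fun v => ?_⟩⟩
  · exact ((hB₀ s hs x).trans (le_abs_self _)).trans (le_add_of_nonneg_right h2)
  · calc ‖Torus.partialDeriv i (g s) x‖ ≤ |Bp i| := (hBp i s hs x).trans (le_abs_self _)
      _ ≤ ∑ j, |Bp j| := Finset.single_le_sum (fun j _ => abs_nonneg (Bp j)) (Finset.mem_univ i)
      _ ≤ |B₀| + ∑ j, |Bp j| := le_add_of_nonneg_left h1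
  have hslice : Torus.IsContDiff 1 (g s) := (hg.isSmooth_slice (hsub hs)).isContDiff (by simp)
  rw [Torus.fderiv_apply_eq_sum_partialDeriv hslice]
  have hsum : ‖∑ i, v i • Torus.partialDeriv i (g s) x‖ ≤ ∑ i, ‖v‖ * |Bp i| := by
    refine (norm_sum_le _ _).trans (Finset.sum_le_sum fun i _ => ?_)
    rw [norm_smul]
    exact mul_le_mul (by simpa using PiLp.norm_apply_le v i) ((hBp i s hs x).trans (le_abs_self _))
      (norm_nonneg _) (norm_nonneg _)
  calc ‖Torus.timeDerivWithin (Ico 0 T) g s x + ∑ i, v i • Torus.partialDeriv i (g s) x‖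
      ≤ |B₀| + ∑ i, ‖v‖ * |Bp i| :=
        (norm_add_le _ _).trans (add_le_add ((hB₀ s hs x).trans (le_abs_self _)) hsum)
    _ = |B₀| + ‖v‖ * ∑ i, |Bp i| := by rw [Finset.mul_sum]
    _ ≤ (|B₀| + ∑ i, |Bp i|) * (1 + ‖v‖) := by
        nlinarith [norm_nonneg v, mul_nonneg h1 (norm_nonneg v)]

section Euler

variable {σ T t : ℝ} {ρ θ : ℝ → T3 → ℝ} {u : ℝ → T3 → V3}

/-- **Window constants of a classical Euler solution.** For `0 ≤ t < T`: bounds `0 < ρ ≤ R`,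
`‖u‖ ≤ U`, `0 < θm ≤ θ ≤ Θ` on `[0, t] × 𝕋³`, and a common constant `B` bounding the time
derivatives (within `[0, T)`), the partial derivatives, and (with linear growth in `v`) the
convective derivatives of `ρ, θ, u` there. [cite: CIP1994, §3.3] -/
theorem k2r_eulerWindow (hEul : IsHardSphereEulerSolution σ T ρ u θ) (ht : 0 ≤ t) (htT : t < T) :
    ∃ R U θm Θ B : ℝ, 0 < θm ∧ 0 ≤ B ∧
      (∀ s ∈ Icc 0 t, ∀ x, 0 < ρ s x ∧ ρ s x ≤ R) ∧ (∀ s ∈ Icc 0 t, ∀ x, ‖u s x‖ ≤ U) ∧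
      (∀ s ∈ Icc 0 t, ∀ x, θm ≤ θ s x ∧ θ s x ≤ Θ) ∧
      (∀ s ∈ Icc 0 t, ∀ x,
        |Torus.timeDerivWithin (Ico 0 T) ρ s x| ≤ B ∧ |Torus.timeDerivWithin (Ico 0 T) θ s x| ≤ B ∧
        ‖Torus.timeDerivWithin (Ico 0 T) u s x‖ ≤ B) ∧
      (∀ s ∈ Icc 0 t, ∀ x, ∀ i : Fin 3,
        |Torus.partialDeriv i (ρ s) x| ≤ B ∧ |Torus.partialDeriv i (θ s) x| ≤ B ∧
        ‖Torus.partialDeriv i (u s) x‖ ≤ B) ∧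
      (∀ s ∈ Icc 0 t, ∀ (x : T3) (v : V3),
        |Torus.timeDerivWithin (Ico 0 T) ρ s x + Torus.fderiv (ρ s) x v| ≤ B * (1 + ‖v‖) ∧
        |Torus.timeDerivWithin (Ico 0 T) θ s x + Torus.fderiv (θ s) x v| ≤ B * (1 + ‖v‖) ∧
        ‖Torus.timeDerivWithin (Ico 0 T) u s x + Torus.fderiv (u s) x v‖ ≤ B * (1 + ‖v‖)) := by
  obtain ⟨_, _, hθc, R, U, Θ, hR, hU, hΘ⟩ := eulerProfiles_window hEul htT
  obtain ⟨θm, hθm, hθm'⟩ := k2r_exists_pos_le_window ht hθc fun s hs x => (hΘ s hs x).1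
  obtain ⟨B₁, hB₁0, hB₁⟩ := k2r_exists_convective_bound hEul.smooth_density htT (t := t)
  obtain ⟨B₂, hB₂0, hB₂⟩ := k2r_exists_convective_bound hEul.smooth_temperature htT (t := t)
  obtain ⟨B₃, hB₃0, hB₃⟩ := k2r_exists_convective_bound hEul.smooth_velocity htT (t := t)
  set B : ℝ := B₁ + B₂ + B₃ with hB
  have hle₁ : B₁ ≤ B := by rw [hB]; linarith
  have hle₂ : B₂ ≤ B := by rw [hB]; linarith
  have hle₃ : B₃ ≤ B := by rw [hB]; linarith
  refine ⟨R, U, θm, Θ, B, hθm, by positivity, hR, hU,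
    fun s hs x => ⟨hθm' s hs x, (hΘ s hs x).2⟩, fun s hs x => ⟨?_, ?_, ?_⟩,
    fun s hs x i => ⟨?_, ?_, ?_⟩, fun s hs x v => ⟨?_, ?_, ?_⟩⟩
  · have h := (hB₁ s hs x).1
    rw [Real.norm_eq_abs] at h
    exact h.trans hle₁
  · have h := (hB₂ s hs x).1
    rw [Real.norm_eq_abs] at h
    exact h.trans hle₂
  · exact (hB₃ s hs x).1.trans hle₃
  · have h := (hB₁ s hs x).2.1 i
    rw [Real.norm_eq_abs] at h
    exact h.trans hle₁
  · have h := (hB₂ s hs x).2.1 i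
    rw [Real.norm_eq_abs] at h
    exact h.trans hle₂
  · exact ((hB₃ s hs x).2.1 i).trans hle₃
  · have h := (hB₁ s hs x).2.2 v
    rw [Real.norm_eq_abs] at h
    exact h.trans (by nlinarith [norm_nonneg v])
  · have h := (hB₂ s hs x).2.2 v
    rw [Real.norm_eq_abs] at h
    exact h.trans (by nlinarith [norm_nonneg v])
  · exact ((hB₃ s hs x).2.2 v).trans (by nlinarith [norm_nonneg v])

/-- **Uniform decay of the local Maxwellian and of its characteristic derivative** (clause (R3)
of the stub). For a classical hard-sphere Euler solution on `[0, T)` and `0 < t < T` there is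
`C_F` with `|f(s,x,v)| (1+|v|)⁸ ≤ C_F` and `|Df(s,x,v)| (1+|v|)⁸ ≤ C_F` for all `s ∈ [0, t]`,
`x`, `v`, where `f = ρ M_{1,θ,u}` and `Df` is the crux's characteristic derivative
`derivWithin (r ↦ f(r, x+(r−s)v, v)) [0,t] s`. [cite: CIP1994, §3.3] -/
theorem k2r_maxwellian_decay (hEul : IsHardSphereEulerSolution σ T ρ u θ) (ht : 0 < t) (htT : t < T) :
    ∃ CF : ℝ, ∀ s ∈ Icc 0 t, ∀ (x : T3) (v : V3),
      |ρ s x * localMaxwellian 1 (θ s x) (u s x) v| * (1 + ‖v‖) ^ 8 ≤ CF ∧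
      |derivWithin (fun r => ρ r (x + Torus.proj ((r - s) • v)) *
          localMaxwellian 1 (θ r (x + Torus.proj ((r - s) • v)))
            (u r (x + Torus.proj ((r - s) • v))) v) (Icc 0 t) s| * (1 + ‖v‖) ^ 8 ≤ CF := by
  obtain ⟨R, U, θm, Θ, B, hθm, hB0, hR, hU, hΘ, -, -, hD⟩ := k2r_eulerWindow hEul ht.le htT
  obtain ⟨C₁, hC₁0, hC₁⟩ := k2r_exists_pow_mul_localMaxwellian_le 8 U θm Θ hθm
  obtain ⟨C₂, hC₂0, hC₂⟩ := k2r_exists_pow_mul_charKernel_le 8 R U θm Θ B hθm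
  have hpos : ∀ r ∈ Ico 0 T, ∀ x, 0 < θ r x := hEul.temperature_pos
  refine ⟨max (|R| * C₁) C₂, fun s hs x v => ⟨?_, ?_⟩⟩
  · have hρx := hR s hs x
    have hθx := hΘ s hs x
    have hM0 : 0 ≤ localMaxwellian 1 (θ s x) (u s x) v :=
      localMaxwellian_nonneg zero_le_one (hθm.le.trans hθx.1) _ v
    refine le_trans ?_ (le_max_left _ _)
    rw [abs_mul, abs_of_pos hρx.1, abs_of_nonneg hM0]
    calc ρ s x * localMaxwellian 1 (θ s x) (u s x) v * (1 + ‖v‖) ^ 8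
        = ρ s x * ((1 + ‖v‖) ^ 8 * localMaxwellian 1 (θ s x) (u s x) v) := by ring
      _ ≤ |R| * C₁ := mul_le_mul (hρx.2.trans (le_abs_self R)) (hC₁ _ _ v hθx.1 hθx.2 (hU s hs x))
          (by positivity) (abs_nonneg R)
  · refine le_trans ?_ (le_max_right _ _)
    rw [k2r_derivWithin_maxwellian_char hEul.smooth_density hEul.smooth_temperature
      hEul.smooth_velocity hpos ht htT hs x v, mul_comm]
    have hρx := hR s hs x
    have hθx := hΘ s hs x
    obtain ⟨h1, h2, h3⟩ := hD s hs x v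
    exact hC₂ (ρ s x) (θ s x) _ _ (u s x) _ v (by rw [abs_of_pos hρx.1]; exact hρx.2) hθx.1 hθx.2
      (hU s hs x) h1 h2 h3

end Euler

section Registered

/-- **Registered form (sub-goal `stub_maxwellianCharDeriv_regularity` of stub B2): clauses
(R1)–(R3).** For a classical hard-sphere Euler solution on `[0, T)` and `t ∈ (0, T)`, the Euler
local Maxwellian `f = ρ M_{1,θ,u}` is jointly continuous after freezing time to `[0, t]`, `C¹` along
every free-flight characteristic on `[0, t]`, and `|f| (1+|v|)⁸`, `|Df| (1+|v|)⁸` are bounded on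
`[0, t]` (`Df` the characteristic derivative within `[0, t]`). [cite: CIP1994, §3.3] -/
theorem stub_maxwellianCharDeriv_regularity :
    ∀ (σ T : ℝ) (ρ θ : ℝ → UnitAddTorus (Fin 3) → ℝ)
      (u : ℝ → UnitAddTorus (Fin 3) → EuclideanSpace ℝ (Fin 3)),
    Literature.MathematicalPhysics.KineticTheory.IsHardSphereEulerSolution σ T ρ u θ →
    ∀ t ∈ Set.Ioo 0 T,
    (Continuous fun p : ℝ × UnitAddTorus (Fin 3) × EuclideanSpace ℝ (Fin 3) =>
      ρ (max 0 (min t p.1)) p.2.1 * Literature.Analysis.FluidPDE.localMaxwellian 1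
        (θ (max 0 (min t p.1)) p.2.1) (u (max 0 (min t p.1)) p.2.1) p.2.2) ∧
    (∀ (x : UnitAddTorus (Fin 3)) (v : EuclideanSpace ℝ (Fin 3)), ContDiffOn ℝ 1
      (fun r : ℝ => ρ r (x + Literature.Analysis.FunctionSpaces.Torus.proj (r • v)) *
        Literature.Analysis.FluidPDE.localMaxwellian 1
          (θ r (x + Literature.Analysis.FunctionSpaces.Torus.proj (r • v)))
          (u r (x + Literature.Analysis.FunctionSpaces.Torus.proj (r • v))) v) (Set.Icc 0 t)) ∧
    (∃ CF : ℝ, ∀ s ∈ Set.Icc 0 t, ∀ (x : UnitAddTorus (Fin 3)) (v : EuclideanSpace ℝ (Fin 3)),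
      |ρ s x * Literature.Analysis.FluidPDE.localMaxwellian 1 (θ s x) (u s x) v| * (1 + ‖v‖) ^ 8 ≤ CF ∧
      |derivWithin (fun r : ℝ =>
          ρ r (x + Literature.Analysis.FunctionSpaces.Torus.proj ((r - s) • v)) *
          Literature.Analysis.FluidPDE.localMaxwellian 1
            (θ r (x + Literature.Analysis.FunctionSpaces.Torus.proj ((r - s) • v)))
            (u r (x + Literature.Analysis.FunctionSpaces.Torus.proj ((r - s) • v))) v)
        (Set.Icc 0 t) s| * (1 + ‖v‖) ^ 8 ≤ CF) := by
  intro σ T ρ θ u hEul t ht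
  obtain ⟨hρc, huc, hθc, -⟩ := eulerProfiles_window hEul ht.2
  have hθpos : ∀ s ∈ Icc 0 t, ∀ x, 0 < θ s x := fun s hs x =>
    hEul.temperature_pos s ⟨hs.1, hs.2.trans_lt ht.2⟩ x
  exact ⟨k2r_continuous_frozen_maxwellian ht.1.le hρc hθc huc hθpos,
    fun x v => k2r_contDiffOn_one_maxwellian_char hEul.smooth_density hEul.smooth_temperature
      hEul.smooth_velocity hEul.temperature_pos ht.2 x v,
    k2r_maxwellian_decay hEul ht.1 ht.2⟩

end Registered

end Summit.AtomisticToContinuum.HydrodynamicLimit.Theorems.EnskogAdjointDuality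

end
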